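import Mathlib
import Literature.Computability.AlgebraicComplexity.PrattTrapezoidVal
import Literature.Combinatorics.Additive.TripleProductProperty
import HarnessLib

/-!
# Pratt 2024: the prime-power packing barrier (Cor. 2.10) and the transfer theorem (Thm. 4.4)
# (statements only)

Topic `Literature/Computability/AlgebraicComplexity` (family `MatrixMultiplication`). Requested by
route `MatrixMultiplication/EisensteinValCertificates`, whose support items `PrimePowerPackingBarrier`
("Pratt Cor 2.10 made explicit … named-fact style; cite filed") and `ValTransfer` ("Pratt Thm 4.4 as
an implication between route decls") and whose target `NoHomocyclicSTPP` ("the contrapositive output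
of Pratt Thm 4.4") are these two printed statements; companion of the tree's `PrattTrapezoidVal.lean`
(Def. 3.2 `IsEquilateralTrapezoidFree`, `prattVal`, Thm. 4.7 `pratt2024_thm47`),
`PrattTrapezoidValBounds.lean` (Prop. 3.1/3.4/3.5 PROVED) and `PrattTrapezoidValSTPP.lean`
(Prop. 3.3 and the mixed-radix embedding of the proof of Thm. 4.4 PROVED).

## The printed statements (K. Pratt, *On generalized corners and matrix multiplication*,
ITCS 2024 = arXiv:2309.03878; held text pp. 6, 9)

"**Corollary 2.10.** There exists an absolute constant `C > 1` such that if `X_i, Y_i, Z_i` satisfy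
the STPP in `ℤ_q^ℓ`, then at least one of `Σ |X_i||Y_i|`, `Σ |X_i||Z_i|`, `Σ |Y_i||Z_i|` is at most
`(q/C)^ℓ`." (p. 6; `q` a prime power as in Thm. 4.4 — proof: the packing-barrier sets
`A₁ = ⊔ X_iY_i⁻¹, …` have `≤ q^{3ℓ/2}` solutions while dense subsets always contain one, and the
tight removal lemma of Fox–Lovász 2017, "only stated for `ℤ_p^ℓ`, it extends to `ℤ_q^ℓ` by the same
argument via [BCCGNSU 2017]" (footnote), forces one `A_j` to be small.)
"**Theorem 4.4.** Suppose that one can achieve `ω = 2` via STPP constructions in the family of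
groups `ℤ_q^ℓ`, `q` a prime power. Then there exists a constant `c > 0` such that
`Val(ℤ_n) ≥ Ω(n^{1+c})`." (p. 9; proof: Cor. 2.10 + Hölder give `Σ (|X_i||Y_i||Z_i|)^{2/3} ≤
(q/C^{1/3})^ℓ`; "If we can obtain `ω < 3 − α` via (prop:stppbound), then
`q^ℓ < Σ (|X_i||Y_i||Z_i|)^{2α/3 + (1−α)}`", whence `Val > (4q)^ℓ` for `α` near `1`; products of
STPPs, the embedding `ℤ_q^N ↪ ℤ_{(3q)^N}`, Prop. 3.3 and Prop. 4.3 (3).)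

## Lean rendering

* STPP family = the tree's `AddSimultaneousTPP` (CKSU 2005 Def. 5.1, additive;
  `TripleProductProperty.lean`; the routes' `IsSTPP` is the same predicate by
  `isSTPP_iff_addSimultaneousTPP`), indexed by a `Fintype ι`, in `H = (Fin ℓ → ZMod q)`.
* `pratt2024_cor210` — Cor. 2.10 verbatim, for families ALL OF WHOSE PARTS ARE NONEMPTY (the
  printed "STPP constructions" realise `⟨|X_i|,|Y_i|,|Z_i|⟩` with positive sizes; without this the
  disjunction fails for junk families: to one genuine triple `({0},{0},Z)` with `Z` a hyperplane one
  may adjoin any number of copies of `({e₁},{0},∅)` without violating the STPP clauses, which are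
  vacuous on empty parts — recorded on route item `PrimePowerPackingBarrier`).
* `pratt2024_thm44` — Thm. 4.4 with its hypothesis read as in the printed proof ("obtain
  `ω < 3 − α` via (prop:stppbound)", i.e. for every `ε > 0` some STPP family in some `ℤ_q^ℓ`, `q` a
  prime power, has `q^ℓ < Σ_i (|X_i||Y_i||Z_i|)^{(2+ε)/3}`) and its conclusion `Val(ℤ_n) ≥ Ω(n^{1+c})`
  as `∃ c > 0, ∃ K > 0, ∀ n ≥ 1, K·n^{1+c} ≤ Val(ℤ/nℤ)` (`prattVal`, `PrattTrapezoidVal.lean`;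
  `NeZero n` supplies finiteness of `ZMod n`). Named facts, not proved here.

What is NOT here: Cor. 2.9 (the `o(n)` form in arbitrary groups), Thm. 2.11, Cor. 4.5 (bounded
number of cyclic factors), Prop. 4.3 (the planar `Val(n)`), and the Fox–Lovász removal lemma itself.

## References

* [Pratt2024] K. Pratt, *On generalized corners and matrix multiplication*, ITCS 2024,
  arXiv:2309.03878 — Cor. 2.10 (p. 6), Thm. 4.4 (p. 9).
* [FoxLovasz2017] J. Fox, L. M. Lovász, *A tight bound for Green's arithmetic triangle removal lemma
  in vector spaces*, SODA 2017 — the removal input of Cor. 2.10.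
* [CohnKleinbergSzegedyUmans2005] Def. 5.1 (STPP), Thm. 5.5 ((prop:stppbound)).
-/

noncomputable section

open scoped BigOperators

namespace Literature.Computability.AlgebraicComplexity

open Literature.Combinatorics.Additive (AddSimultaneousTPP)

/-- **Pratt 2024, Corollary 2.10** ("There exists an absolute constant `C > 1` such that if
`X_i, Y_i, Z_i` satisfy the STPP in `ℤ_q^ℓ`, then at least one of `Σ |X_i||Y_i|`, `Σ |X_i||Z_i|`,
`Σ |Y_i||Z_i|` is at most `(q/C)^ℓ`"), for `q` a prime power and STPP families with all parts
nonempty (module docstring). Grounds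
`Summit.MatrixMultiplication.MatrixMultiplication.Theses.EisensteinValCertificates.PrimePowerPackingBarrier`
(which is this statement with an extra constant `K`, once nonemptiness is added there). A named
fact, not proved here. [cite: Pratt2024, Cor. 2.10] -/
def pratt2024_cor210 : Prop :=
  ∃ C : ℝ, 1 < C ∧ ∀ (q ℓ : ℕ), IsPrimePow q → ∀ (ι : Type) [Fintype ι]
    (X Y Z : ι → Finset (Fin ℓ → ZMod q)), AddSimultaneousTPP X Y Z →
    (∀ i, (X i).Nonempty ∧ (Y i).Nonempty ∧ (Z i).Nonempty) →
      (∑ i, (((X i).card * (Y i).card : ℕ) : ℝ)) ≤ ((q : ℝ) / C) ^ ℓ ∨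
      (∑ i, (((X i).card * (Z i).card : ℕ) : ℝ)) ≤ ((q : ℝ) / C) ^ ℓ ∨
      (∑ i, (((Y i).card * (Z i).card : ℕ) : ℝ)) ≤ ((q : ℝ) / C) ^ ℓ

/-- **Pratt 2024, Theorem 4.4** ("Suppose that one can achieve `ω = 2` via STPP constructions in
the family of groups `ℤ_q^ℓ`, `q` a prime power. Then there exists a constant `c > 0` such that
`Val(ℤ_n) ≥ Ω(n^{1+c})`"): if for every `ε > 0` some STPP family in some `(ℤ/q)^ℓ`, `q` a prime
power, has `q^ℓ < Σ_i (|X_i||Y_i||Z_i|)^{(2+ε)/3}` (the certificate that would give `ω ≤ 2 + ε`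
through CKSU Thm. 5.5), then `K·n^{1+c} ≤ Val(ℤ/nℤ)` for some `c, K > 0` and all `n ≥ 1`. Grounds
`Summit.MatrixMultiplication.MatrixMultiplication.Theses.EisensteinValCertificates.ValTransfer` and
the target `NoHomocyclicSTPP` (its contrapositive output given Conj. 4.1 at primes). A named fact,
not proved here (the transport half of the printed proof is PROVED in `PrattTrapezoidValSTPP.lean`).
[cite: Pratt2024, Thm. 4.4] -/
def pratt2024_thm44 : Prop :=
  (∀ ε : ℝ, 0 < ε → ∃ (q ℓ : ℕ) (_ : IsPrimePow q) (ι : Type) (_ : Fintype ι)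
      (X Y Z : ι → Finset (Fin ℓ → ZMod q)), AddSimultaneousTPP X Y Z ∧
        (q : ℝ) ^ ℓ < ∑ i, (((X i).card * (Y i).card * (Z i).card : ℕ) : ℝ) ^ ((2 + ε) / 3)) →
    ∃ c : ℝ, 0 < c ∧ ∃ K : ℝ, 0 < K ∧ ∀ (n : ℕ) (_ : NeZero n),
      K * (n : ℝ) ^ (1 + c) ≤ (prattVal (ZMod n) : ℝ)

end Literature.Computability.AlgebraicComplexity

end
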